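import Literature.AlgebraicGeometry.AbelianSchemes.SerreTensorComposition
import HarnessLib

/-!
# `Aⁿ` as a COPRODUCT of commutative group schemes: the inclusions `incl_k : A ⟶ Aⁿ`, the decomposition `𝟙 = ∏_k pr_k ≫ incl_k`,
# and the equivariance of the Serre projection `π : Aⁿ ⟶ A ⊗_𝒪 𝔟`

Topic `AlgebraicGeometry/AbelianSchemes`, namespace `Literature.AlgebraicGeometry.AbelianSchemes.AbelianSchemeOver` (one construction with body,
`powIncl`, + proved theorems; no named fact, no `sorry`, no `instance`, no notation; ANY base scheme `S`).  Cell `hodgecm-mathlib`, F0/P6 «MOD»,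
plumbing for organ **ST-4 (contravariant half)** of desk F0P6a-plan (g0) (ED3-CENSUS-P6a v1 §6: `Hom_𝒪(A₀ ⊗_𝒪 𝔟₀, Y) ≅ Hom_𝒪(A₀, Y) ⊗ 𝔟₀^∨` needs
homomorphisms OUT of `A₀ⁿ`), over ★ FILES 2∕3∕6b (`SerreTensorConstruction`, `SerreTensorFunctoriality`, `SerreTensorComposition`);
`--supports stmt-HodgeConjecture-24832`, count-neutral.  HC_CM is proved only modulo the 2 remaining named inputs (hLiu418, h413) until rung 0
closes; this file discharges none of them.

## Mathematics

In the additive category of commutative group schemes over `S`, `Aⁿ` (★ `pow`, with projections `pr_k`, ★ `powProj`) is also a coproduct: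
`incl_k := (δ_{jk})_j : A → Aⁿ` (§1) satisfies `incl_k ≫ pr_j = δ_{jk}` and `∑_k pr_k incl_k = 𝟙_{Aⁿ}` — multiplicatively
`∏_k pr_k ≫ incl_k = 𝟙` in the group `Hom(Aⁿ, Aⁿ)` (§2; the Prop hypothesis `[IsCommMonObj (A.pow n).X]` of these statements is ★
`isCommMonObj_pow`, supplied by consumers with `haveI`).  Hence every map INTO `Aⁿ` is `c = ∏_k (c ≫ pr_k) ≫ incl_k` and every HOMOMORPHISM
OUT of `Aⁿ` into a commutative group is `f = ∏_k pr_k ≫ (incl_k ≫ f)`, determined by its components `incl_k ≫ f` (§2); the matrix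
endomorphism `[M]` (★ `matrixEnd`) has entries `incl_k ≫ [M] ≫ pr_j = ι(M_{jk})` (§3).  For the Serre tensor `A ⊗_𝒪 𝔟 = Fix([E])`: `[E] ≫ π = π`
and `π` intertwines the scalar `[a·1]` with the Serre action `ι_{A⊗𝔟}(a)` (§4) ([MumfordFogartyKirwan1994] Ch. 6 §1 (products of abelian
schemes); B. Conrad, *Gross–Zagier revisited* §7).

## Contents

* §1 **`powIncl A n k : A.X ⟶ (A.pow n).X`**, `powIncl_powProj`, `powIncl_powProj_self`, `powIncl_powProj_ne`, `isMonHom_powIncl`.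
* §2 **`prod_powProj_comp_powIncl`** (`∏_k pr_k ≫ incl_k = 𝟙`), `eq_prod_comp_powProj_powIncl` (maps into `Aⁿ`),
  **`eq_prod_powProj_comp_powIncl_comp`** (homomorphisms out of `Aⁿ`), `hom_out_ext` , `powIncl_comp_prod_powProj_comp` (`incl_j ≫ ∏_l pr_l ≫ g_l = g_j`),
  `powIncl_powMap`.
* §3 `powIncl_matrixEnd_powProj` (`incl_k ≫ [M] ≫ pr_j = ι(M j k)`), `powIncl_matrixEnd` (`incl_k ≫ [M] = ∏_j ι(M j k) ≫ incl_j`).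
* §4 `matrixEnd_comp_serreπ` (`[E] ≫ π = π`), **`matrixEnd_scalar_comp_serreπ`** (`[a·1] ≫ π = π ≫ ι_{A⊗𝔟}(a)`), `powIncl_scalar` (`ι(a) ≫ incl_k = incl_k ≫ [a·1]`).

## References
* [MumfordFogartyKirwan1994] D. Mumford, J. Fogarty, F. Kirwan, *Geometric Invariant Theory* (3rd ed.), Ch. 6 §1 Def. 6.1 (p. 115), Cor. 6.4 (p. 117).
* [Conrad2004GrossZagier] B. Conrad, *Gross–Zagier revisited*, MSRI Publ. 49 (2004), §7 (Thm. 7.5).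
* [Kottwitz1992] R. Kottwitz, JAMS 5 (1992), §5 (p. 390) (the matrix calculus `M ↦ [M]`).
-/

noncomputable section

universe u

open CategoryTheory CategoryTheory.Limits AlgebraicGeometry MonoidalCategory CartesianMonoidalCategory
open scoped MonObj

namespace Literature.AlgebraicGeometry.AbelianSchemes

namespace AbelianSchemeOver

variable {S : Scheme.{u}} (A : AbelianSchemeOver S) (n : ℕ)

/-! ## §1 The inclusions `incl_k : A ⟶ Aⁿ` -/

/-- **`incl_k : A ⟶ Aⁿ`**, the `k`-th coproduct inclusion: coordinates `δ_{jk}` (`𝟙` at `j = k`, the unit `1` elsewhere).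
[cite: MumfordFogartyKirwan1994, Ch. 6 §1 Definition 6.1 (p. 115)] -/
def powIncl (k : Fin n) : A.X ⟶ (A.pow n).X := powLift fun j => if j = k then 𝟙 A.X else 1

/-- `incl_k ≫ pr_j = δ_{jk}`. [cite: MumfordFogartyKirwan1994, Ch. 6 §1 Definition 6.1 (p. 115)] -/
theorem powIncl_powProj (k j : Fin n) : A.powIncl n k ≫ A.powProj n j = if j = k then 𝟙 A.X else 1 :=
  powLift_powProj _ _

/-- `incl_k ≫ pr_k = 𝟙`. [cite: MumfordFogartyKirwan1994, Ch. 6 §1 Definition 6.1 (p. 115)] -/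
@[reassoc]
theorem powIncl_powProj_self (k : Fin n) : A.powIncl n k ≫ A.powProj n k = 𝟙 A.X := by
  rw [powIncl_powProj, if_pos rfl]

/-- `incl_k ≫ pr_j = 1` for `j ≠ k`. [cite: MumfordFogartyKirwan1994, Ch. 6 §1 Definition 6.1 (p. 115)] -/
@[reassoc]
theorem powIncl_powProj_ne {k j : Fin n} (h : j ≠ k) : A.powIncl n k ≫ A.powProj n j = 1 := by
  rw [powIncl_powProj, if_neg h]

/-- `incl_k` is a homomorphism. [cite: MumfordFogartyKirwan1994, Ch. 6 §1 Corollary 6.4 (p. 117)] -/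
theorem isMonHom_powIncl (k : Fin n) : IsMonHom (A.powIncl n k) := by
  refine isMonHom_powLift _ fun j => ?_
  by_cases h : j = k
  · rw [if_pos h]; infer_instance
  · rw [if_neg h, Hom.one_def]; infer_instance

/-- `incl_j ≫ ∏_l pr_l ≫ g_l = g_j` for homomorphisms `g_l : A → Y` (the component of the map assembled from the `g_l`).
[cite: MumfordFogartyKirwan1994, Ch. 6 §1 Corollary 6.4 (p. 117)] -/
theorem powIncl_comp_prod_powProj_comp {Y : Over S} [GrpObj Y] [IsCommMonObj Y] (g : Fin n → (A.X ⟶ Y)) (hg : ∀ k, IsMonHom (g k))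
    (j : Fin n) : A.powIncl n j ≫ ∏ l : Fin n, A.powProj n l ≫ g l = g j := by
  rw [comp_finset_prod, Finset.prod_eq_single j (fun l _ hlj => ?_) (fun h => absurd (Finset.mem_univ j) h), ← Category.assoc,
    powIncl_powProj_self, Category.id_comp]
  haveI := hg l
  rw [← Category.assoc, A.powIncl_powProj_ne n hlj, MonObj.one_comp]

/-- `incl_k` intertwines `g` with `gⁿ`: `incl_k ≫ gⁿ = g ≫ incl_k` (for a homomorphism `g`). [cite: MumfordFogartyKirwan1994, Ch. 6 §1 Corollary 6.4 (p. 117)] -/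
theorem powIncl_powMap (g : A.X ⟶ A.X) [IsMonHom g] (k : Fin n) : A.powIncl n k ≫ powMap g n = g ≫ A.powIncl n k := by
  refine pow_hom_ext fun j => ?_
  rw [Category.assoc, powMap_powProj, ← Category.assoc, Category.assoc g, powIncl_powProj]
  by_cases h : j = k
  · rw [if_pos h, Category.id_comp, Category.comp_id]
  · rw [if_neg h, MonObj.one_comp, MonObj.comp_one]


/-! ## §2 `∏_k pr_k ≫ incl_k = 𝟙` and the two decompositions -/

section Decomposition

variable [IsCommMonObj A.X] [IsCommMonObj (A.pow n).X]

/-- **`∏_k pr_k ≫ incl_k = 𝟙_{Aⁿ}`** in the group `Hom(Aⁿ, Aⁿ)` («`∑ incl_k pr_k = id`»). [cite: MumfordFogartyKirwan1994, Ch. 6 §1 Corollary 6.4 (p. 117)] -/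
theorem prod_powProj_comp_powIncl : ∏ k : Fin n, (A.powProj n k ≫ A.powIncl n k) = 𝟙 (A.pow n).X := by
  refine pow_hom_ext fun j => ?_
  haveI := A.isMonHom_powProj n j
  rw [finset_prod_comp, Category.id_comp,
    Finset.prod_eq_single j (fun k _ hkj => by rw [Category.assoc, A.powIncl_powProj_ne n (Ne.symm hkj), MonObj.comp_one])
      (fun h => absurd (Finset.mem_univ j) h), Category.assoc, powIncl_powProj_self, Category.comp_id]

/-- Every map INTO `Aⁿ` decomposes: `c = ∏_k (c ≫ pr_k) ≫ incl_k`. [cite: MumfordFogartyKirwan1994, Ch. 6 §1 Corollary 6.4 (p. 117)] -/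
theorem eq_prod_comp_powProj_powIncl {T : Over S} (c : T ⟶ (A.pow n).X) : c = ∏ k : Fin n, (c ≫ A.powProj n k) ≫ A.powIncl n k := by
  conv_lhs => rw [← Category.comp_id c, ← A.prod_powProj_comp_powIncl n]
  rw [comp_finset_prod]
  simp only [Category.assoc]

/-- **Every HOMOMORPHISM OUT of `Aⁿ`** into a commutative group decomposes: `f = ∏_k pr_k ≫ (incl_k ≫ f)`.
[cite: MumfordFogartyKirwan1994, Ch. 6 §1 Corollary 6.4 (p. 117)] -/
theorem eq_prod_powProj_comp_powIncl_comp {Y : Over S} [GrpObj Y] [IsCommMonObj Y] (f : (A.pow n).X ⟶ Y) [IsMonHom f] :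
    f = ∏ k : Fin n, A.powProj n k ≫ A.powIncl n k ≫ f := by
  conv_lhs => rw [← Category.id_comp f, ← A.prod_powProj_comp_powIncl n]
  rw [finset_prod_comp]
  simp only [Category.assoc]

/-- Two homomorphisms out of `Aⁿ` into a commutative group agree iff they agree on every `incl_k`.
[cite: MumfordFogartyKirwan1994, Ch. 6 §1 Corollary 6.4 (p. 117)] -/
theorem hom_out_ext {Y : Over S} [GrpObj Y] [IsCommMonObj Y] (f f' : (A.pow n).X ⟶ Y) [IsMonHom f] [IsMonHom f']
    (h : ∀ k, A.powIncl n k ≫ f = A.powIncl n k ≫ f') : f = f' := by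
  rw [A.eq_prod_powProj_comp_powIncl_comp n f, A.eq_prod_powProj_comp_powIncl_comp n f']
  exact Finset.prod_congr rfl fun k _ => by rw [h k]

end Decomposition

/-! ## §3 Entries of the matrix endomorphism: `incl_k ≫ [M] ≫ pr_j = ι(M j k)` -/

section MatrixEntries

variable {A} {O : Type*} [CommRing O] (act : A.RingAction O) [IsCommMonObj A.X]

/-- **`incl_k ≫ [M] ≫ pr_j = ι(M_{jk})`** (the `(j,k)` entry of `[M]`). [cite: Kottwitz1992, §5 (p. 390)] -/
theorem powIncl_matrixEnd_powProj (M : Matrix (Fin n) (Fin n) O) (k j : Fin n) :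
    A.powIncl n k ≫ matrixEnd act M ≫ A.powProj n j = act.i (M j k) := by
  have h := congrFun (powHomEquiv_comp_matrixEnd act M (A.powIncl n k)) j
  rw [powHomEquiv_apply, Category.assoc] at h
  rw [h]
  unfold matrixComp
  rw [Finset.prod_eq_single k (fun l _ hlk => ?_) (fun h => absurd (Finset.mem_univ k) h), powHomEquiv_apply,
    powIncl_powProj_self, Category.id_comp]
  haveI := act.isMonHom (M j l)
  rw [powHomEquiv_apply, A.powIncl_powProj_ne n hlk, MonObj.one_comp]

/-- `incl_k ≫ [M] = ∏_j ι(M_{jk}) ≫ incl_j` (the `k`-th column of `[M]`). [cite: Kottwitz1992, §5 (p. 390)] -/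
theorem powIncl_matrixEnd [IsCommMonObj (A.pow n).X] (M : Matrix (Fin n) (Fin n) O) (k : Fin n) :
    A.powIncl n k ≫ matrixEnd act M = ∏ j : Fin n, act.i (M j k) ≫ A.powIncl n j := by
  rw [A.eq_prod_comp_powProj_powIncl n (A.powIncl n k ≫ matrixEnd act M)]
  exact Finset.prod_congr rfl fun j _ => by
    simpa only [Category.assoc] using congrArg (· ≫ A.powIncl n j) (powIncl_matrixEnd_powProj n act M k j)

/-- `ι(a) ≫ incl_k = incl_k ≫ [a·1]`. [cite: Kottwitz1992, §5 (p. 390)] -/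
theorem powIncl_scalar (a : O) (k : Fin n) : act.i a ≫ A.powIncl n k = A.powIncl n k ≫ matrixEnd act (Matrix.scalar (Fin n) a) := by
  haveI := act.isMonHom a
  rw [matrixEnd_scalar_eq_powMap, powIncl_powMap]

end MatrixEntries

/-! ## §4 The Serre projection `π : Aⁿ ⟶ A ⊗_𝒪 𝔟` absorbs `[E]` and is equivariant -/

section SerreProjection

variable {A} {O : Type*} [CommRing O] (act : A.RingAction O) [IsCommMonObj A.X] (E : Matrix (Fin n) (Fin n) O) (hE : E * E = E)

/-- `[E] ≫ π = π` (`[E] = π ≫ ι`, `ι ≫ π = 𝟙`). [cite: Conrad2004GrossZagier, §7 (Thm. 7.5)] -/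
@[reassoc]
theorem matrixEnd_comp_serreπ : matrixEnd act E ≫ serreπ act E hE = serreπ act E hE := by
  rw [← (serreπ_ι_and_ι_π act E hE).1, Category.assoc, (serreπ_ι_and_ι_π act E hE).2, Category.comp_id]

/-- **`π` is equivariant**: `[a·1] ≫ π = π ≫ ι_{A⊗𝔟}(a)`. [cite: Conrad2004GrossZagier, §7 (Thm. 7.5)] -/
@[reassoc]
theorem matrixEnd_scalar_comp_serreπ (a : O) :
    matrixEnd act (Matrix.scalar (Fin n) a) ≫ serreπ act E hE = serreπ act E hE ≫ (serreAction act E hE).i a := by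
  haveI := (isMonHom_serreι_serreπ act E hE).2.2
  rw [← cancel_mono (serreι act E hE), Category.assoc, Category.assoc, serreAction_i_comp_ι, (serreπ_ι_and_ι_π act E hE).1,
    ← Category.assoc, (serreπ_ι_and_ι_π act E hE).1, matrixEnd_scalar_comm]

/-- `ι(a) ≫ incl_k ≫ π = incl_k ≫ π ≫ ι_{A⊗𝔟}(a)`: the composite `incl_k ≫ π : A → A ⊗_𝒪 𝔟` is equivariant. [cite: Conrad2004GrossZagier, §7 (Thm. 7.5)] -/
@[reassoc]
theorem i_comp_powIncl_serreπ (a : O) (k : Fin n) :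
    act.i a ≫ A.powIncl n k ≫ serreπ act E hE = A.powIncl n k ≫ serreπ act E hE ≫ (serreAction act E hE).i a := by
  rw [← Category.assoc, powIncl_scalar, Category.assoc, matrixEnd_scalar_comp_serreπ]

end SerreProjection

end AbelianSchemeOver

end Literature.AlgebraicGeometry.AbelianSchemes

end
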